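import Literature.NumberTheory.Transcendental.RoySmallValueEstimatesLevelNumericsProofs
import Literature.NumberTheory.Transcendental.RoySmallValueEstimatesReductionProofs
import HarnessLib

/-!
# Small value estimates at rational translates (Nguyen–Roy 2016) — proofs: Theorem 1 outside the corner `σ = 1 ∧ |s| < 1`

Proofs file towards `Literature.NumberTheory.Transcendental.nguyenRoy2016_thm_1` (Nguyen–Roy, IJNT 12
(2016) = arXiv:1412.5163). Everything here is PROVED. Source, §6 (p. 14):

> *Proof of Theorem 1.* Suppose on the contrary that `(ξ, η) ∉ ℚ̄ × ℚ̄` [...] (the contradiction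
> is derived from Propositions 14, 17, Corollaries 18, 19, Lemmas 5, 6, 11, Propositions 4, 12).

and §2, Lemma 3 (the reduction of `|s| < 1` to `|s| > 1`).

This file assembles the proof:

* `LevelProps`, `ptSeq`, `propsAt_ptSeq`, `eventually_levelProps` — the forms `P̃_D` of
  Proposition 4 (`NguyenRoy.prop4`) as a sequence; `Good D` — Proposition 4 at `D` together with
  the largeness conditions of `RoySmallValueEstimatesLevelNumericsProofs`; `eventually_good`;
* `defaultAlgPt`, `Zseq`, `selOfGood`, `card_M₁_le`, `log_length_le_of_good`, and the three
  suppliers `prop14_of_good`, `cor16_of_good`, `notIn_of_good` with the concrete constants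
  `A₁₄ = 4`, `B₁₄ = 77`, `κ = 1/640`, `c₇ = 0`;
* **`endgame`** — the `NguyenRoy.EndgameData σ β ν` of `RoySmallValueEstimatesEndgameAssemblyProofs`
  built from the projective plane / algebraic points / Lemmas 5, 11 / Propositions 10, 12 of the
  instantiation files (`RoySmallValueEstimatesProjPlaneProofs`, `…AlgPointProofs`,
  `…AlgPointLiouvilleProofs`, `…ClosestGamPProofs`, `…NotInProofs`) and Propositions 14, 15,
  Corollary 16 of `RoySmallValueEstimatesLevelDataProofs`, when `|s| > 1` and
  `(ξ, η) ∉ ℚ̄ × ℚ̄`;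
* **`thm1_of_one_lt_abs_s`** — Theorem 1 for `|s| > 1` (all `1 ≤ σ < 2`), by
  `EndgameData.false_of_constraints`; **`thm1_of_one_lt_sigma`** — Theorem 1 for `1 < σ < 2` and
  all `s ≠ 0, ±1`, by the repaired Lemma 3 (`NguyenRoy.thm1_of_one_lt_abs`,
  `RoySmallValueEstimatesReductionProofs`);
* the named fact **`nguyenRoy2016_thm_1'`** = `nguyenRoy2016_thm_1` with the extra hypothesis
  `1 < σ ∨ 1 < |s|`, and **`nguyenRoy2016_thm_1'_holds`**. The remaining corner
  `σ = 1 ∧ |s| < 1` of the printed statement is NOT covered by the printed proof: its Lemma 3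
  passes from `P_{⌊D/2⌋}` to `P̃_D = X₂^{⌊D/2⌋}P_{⌊D/2⌋}(X₁, X₂⁻¹)`, which is small at
  `4⌊⌊D/2⌋^σ⌋ < 4⌊D^σ⌋` translates only; for `σ > 1` the openness of the constraints (1) absorbs
  the loss (`RoySmallValueEstimatesReductionProofs`), at `σ = 1` it does not (see the docstring of
  `nguyenRoy2016_thm_1'`).

## References

* [NguyenRoy2016] N. A. V. Nguyen, D. Roy, IJNT 12 (2016) 1273–1293 = arXiv:1412.5163, Theorem 1,
  Lemma 3, Proposition 4, §§5–6.
-/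

noncomputable section

open MvPolynomial Finset Module Filter Topology Height
open scoped Classical

namespace Literature.NumberTheory.Transcendental

namespace NguyenRoy

open Roy2013
open Nesterenko hiding tau

/-! ### The forms `P̃_D` as a sequence -/

section seq

variable (ξ η : ℂ) (r s : ℚ) (σ β ν : ℝ)

/-- The properties of `P̃_D` delivered by Proposition 4 at the level `D`. [cite: NguyenRoy2016, Proposition 4] -/
def LevelProps (D : ℕ) (Pt : MvPolynomial (Fin 3) ℤ) : Prop :=
  Pt.IsHomogeneous D ∧ Pt ≠ 0 ∧ (∃ e ∈ Pt.support, e 0 = 0) ∧ (∃ e ∈ Pt.support, e 2 = 0) ∧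
    ∀ i : ℕ, i < 4 * ⌊(D : ℝ) ^ σ⌋₊ →
      (∃ Q : MvPolynomial (Fin 3) ℤ, Q.IsHomogeneous D ∧
        map (Int.castRingHom ℂ) Q =
          tau ((i : ℂ) * (r : ℂ)) ((s : ℂ) ^ i) (map (Int.castRingHom ℂ) Pt) ∧
        (mvPolyHeight Q : ℝ) ≤ Real.exp (2 * (D : ℝ) ^ β)) ∧
      ‖aeval ![(1 : ℂ), ξ + (i : ℂ) * (r : ℂ), η * (s : ℂ) ^ i] Pt‖ ≤ Real.exp (-(D : ℝ) ^ ν / 2)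

/-- **The sequence `P̃_D`** (a choice of a form with the properties of Proposition 4, when one
exists). [cite: NguyenRoy2016, §5 ("we fix a choice of polynomials `P̃_D` as in Proposition 4")] -/
def ptSeq (D : ℕ) : MvPolynomial (Fin 3) ℤ :=
  if h : ∃ Pt : MvPolynomial (Fin 3) ℤ, LevelProps ξ η r s σ β ν D Pt then h.choose else 0

variable {ξ η r s σ β ν}

/-- `P̃_D` has the properties whenever some form has them. [folklore] -/
theorem propsAt_ptSeq {D : ℕ} (h : ∃ Pt : MvPolynomial (Fin 3) ℤ, LevelProps ξ η r s σ β ν D Pt) :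
    PropsAt ξ η r s σ β ν (ptSeq ξ η r s σ β ν) D ∧ SuppAt (ptSeq ξ η r s σ β ν) D := by
  have hspec : LevelProps ξ η r s σ β ν D (ptSeq ξ η r s σ β ν D) := by
    rw [ptSeq, dif_pos h]; exact h.choose_spec
  obtain ⟨h1, h2, h3, h4, h5⟩ := hspec
  exact ⟨⟨h1, h2, fun i hi => h5 i hi⟩, h3, h4⟩

/-- **Proposition 4, sequence form.** [cite: NguyenRoy2016, Proposition 4] -/
theorem eventually_levelProps (hη : η ≠ 0) (hs : s ≠ 0) (hσ1 : 1 ≤ σ) (hβ : σ + 1 < β)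
    (hν : σ + 1 < ν)
    (hP : ∀ᶠ D : ℕ in atTop, ∃ P : MvPolynomial (Fin 2) ℤ, P ≠ 0 ∧ P.totalDegree ≤ D ∧
      (mvPolyHeight P : ℝ) ≤ Real.exp ((D : ℝ) ^ β) ∧
      ∀ i : ℕ, i < 4 * ⌊(D : ℝ) ^ σ⌋₊ →
        ‖aeval ![ξ + (i : ℂ) * (r : ℂ), η * (s : ℂ) ^ i] P‖ ≤ Real.exp (-(D : ℝ) ^ ν)) :
    ∀ᶠ D : ℕ in atTop, ∃ Pt : MvPolynomial (Fin 3) ℤ, LevelProps ξ η r s σ β ν D Pt :=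
  prop4 hη hs hσ1 hβ hν hP

end seq

/-! ### The good levels -/

section good

variable (ξ η : ℂ) (r s : ℚ) (σ β ν : ℝ)

/-- A level `D` is good when Proposition 4 holds at `D` and all largeness conditions are met.
[cite: NguyenRoy2016, §5 ("for `D` sufficiently large")] -/
def Good (D : ℕ) : Prop :=
  2 ≤ D ∧ (∃ Pt : MvPolynomial (Fin 3) ℤ, LevelProps ξ η r s σ β ν D Pt) ∧ Lc σ D < D ∧
    interpConst ξ η (r : ℂ) (s : ℂ) (Lc σ D) ≤ Real.exp (Yl β D) ∧
    (D : ℝ) * ((D : ℝ) ^ 2) ^ D * Real.exp (2 * (D : ℝ) ^ β) ≤ Real.exp (Yl β D) ∧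
    (D : ℝ) * ((D : ℝ) ^ 2) ^ D * Real.exp (-(D : ℝ) ^ ν / 2) ≤ Real.exp (-Ul ν D) ∧
    Real.log (S0 σ β ν D) ≤ -((D : ℝ) ^ (σ + ν)) / 16 ∧
    Real.log (2 * c10 ξ η (r : ℂ) (s : ℂ) (Lc σ D)) ≤ (D : ℝ) ^ β ∧
    Real.log ((Fintype.card (PhiRow D)).factorial : ℝ) +
      2 * Fintype.card ↥(finsuppAntidiag (univ : Finset (Fin 3)) (2 * D)) * Yl β D ≤
        38 * (D : ℝ) ^ (2 + β) ∧
    4 * AlgPt.c4 r s * (D : ℝ) ^ 2 ≤ (D : ℝ) ^ (1 + β - σ)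

variable {ξ η r s σ β ν}

/-- **All large levels are good.** [cite: NguyenRoy2016, §5] -/
theorem eventually_good (hη : η ≠ 0) (hs0 : s ≠ 0) (hs : 1 < ‖(s : ℂ)‖) (hσ1 : 1 ≤ σ) (hσ2 : σ < 2)
    (hβ : σ + 1 < β) (hν : 2 + β - σ < ν)
    (hP : ∀ᶠ D : ℕ in atTop, ∃ P : MvPolynomial (Fin 2) ℤ, P ≠ 0 ∧ P.totalDegree ≤ D ∧
      (mvPolyHeight P : ℝ) ≤ Real.exp ((D : ℝ) ^ β) ∧
      ∀ i : ℕ, i < 4 * ⌊(D : ℝ) ^ σ⌋₊ →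
        ‖aeval ![ξ + (i : ℂ) * (r : ℂ), η * (s : ℂ) ^ i] P‖ ≤ Real.exp (-(D : ℝ) ^ ν)) :
    ∀ᶠ D : ℕ in atTop, Good ξ η r s σ β ν D := by
  have hσ0 : 0 ≤ σ := by linarith
  have hσβ : 3 * σ / 2 < β := by linarith
  filter_upwards [eventually_ge_atTop 2, eventually_levelProps hη hs0 hσ1 hβ (by linarith) hP,
    eventually_Lc_lt hσ0 hσ2, eventually_interpConst_le ξ η (r : ℂ) hs hσ0 hσβ,
    eventually_slack_Y (show (1 : ℝ) < β by linarith), eventually_slack_U (show (1 : ℝ) < ν by linarith),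
    eventually_log_S0_le (β := β) (ν := ν) hσ1 (by linarith) (by linarith),
    eventually_log_c10_le ξ η (r : ℂ) hs hσ0 hσβ,
    eventually_heightSum_le (show (0 : ℝ) < β by linarith), eventually_c4_le r s hβ]
    with D h1 h2 h3 h4 h5 h6 h7 h8 h9 h10
  exact ⟨h1, h2, h3, h4, h5, h6, h7, h8, h9, h10⟩

/-- The selected orbit of a good level. [cite: NguyenRoy2016, Proposition 15] -/
def selOfGood (hr : r ≠ 0) (hs0 : s ≠ 0) (hs1 : s ≠ 1) (hs2 : s ≠ -1) (hη : η ≠ 0)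
    (hs : 1 < ‖(s : ℂ)‖) (hσ1 : 1 ≤ σ) {D : ℕ} (h : Good ξ η r s σ β ν D) :
    LevelSel ξ η r s σ β ν (ptSeq ξ η r s σ β ν) D :=
  Classical.choice (exists_levelSel (by have := h.1; omega) (propsAt_ptSeq h.2.1).1 (propsAt_ptSeq h.2.1).2
    hσ1 hr hs0 hs1 hs2 hη hs h.2.2.1.le h.2.2.2.1 h.2.2.2.2.1 h.2.2.2.2.2.1
    (by
      have h7 := h.2.2.2.2.2.2.1
      have hD0 : 0 < D := by have := h.1; omega
      have hpos : 0 < (D : ℝ) ^ (σ + ν) := Real.rpow_pos_of_pos (by exact_mod_cast hD0) _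
      have hlt : Real.log (S0 σ β ν D) < 0 := by linarith
      exact (Real.log_neg_iff (S0_pos σ β ν D)).mp hlt))

/-- The point `(0:1:0)` as an algebraic point (a default value). [folklore] -/
def defaultAlgPt : AlgPt :=
  ⟨Projectivization.mk ℂ ![0, 1, 0] e010_ne_zero,
    ⟨⟨ℚ, algebraMap ℚ ℂ, ![0, 1, 0],
      (fun h => by
        have := congrFun h 1
        simp at this),
      mk_congr _ _ (by funext j; fin_cases j <;> simp)⟩⟩⟩

variable (ξ η r s σ β ν) in
/-- **The subvarieties `Z_D`** (the selected orbit at good levels, a default value otherwise).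
[cite: NguyenRoy2016, Proposition 15] -/
def Zseq (hr : r ≠ 0) (hs0 : s ≠ 0) (hs1 : s ≠ 1) (hs2 : s ≠ -1) (hη : η ≠ 0)
    (hs : 1 < ‖(s : ℂ)‖) (hσ1 : 1 ≤ σ) (D : ℕ) : AlgPt :=
  if h : Good ξ η r s σ β ν D then (selOfGood hr hs0 hs1 hs2 hη hs hσ1 h).Z else defaultAlgPt

/-! ### Bounds at a good level -/

/-- `#M₁ ≤ dim ℂ[X]_{2D}` (the monomials of `M₁` have degree `2D`). [folklore] -/
theorem card_M₁_le {D : ℕ} {Pt Qt : MvPolynomial (Fin 3) ℤ} (L : PairPkg D Pt Qt) :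
    Fintype.card ↥L.M₁ ≤ Fintype.card ↥(finsuppAntidiag (univ : Finset (Fin 3)) (2 * D)) := by
  rw [Fintype.card_coe, Fintype.card_coe]
  refine card_le_card fun μ hμ => ?_
  rw [mem_finsuppAntidiag]
  refine ⟨?_, subset_univ _⟩
  rw [← L.hM₁ μ hμ, Finsupp.degree]
  exact (Finset.sum_subset (subset_univ _) fun i _ hi => Finsupp.notMem_support_iff.mp hi).symm

/-- **`log 𝓛(Φ(P̃_D, Q, ·)) ≤ 38 D^{2+β}`** at a good level. [cite: NguyenRoy2016, proof of Proposition 14 (`h(W) ≤ 5D^{1+β}`)] -/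
theorem log_length_le_of_good (hr : r ≠ 0) (hs0 : s ≠ 0) (hs1 : s ≠ 1) (hs2 : s ≠ -1) (hη : η ≠ 0)
    (hs : 1 < ‖(s : ℂ)‖) (hσ1 : 1 ≤ σ) {D : ℕ} (h : Good ξ η r s σ β ν D) :
    Real.log (∑ n ∈ (selOfGood hr hs0 hs1 hs2 hη hs hσ1 h).L.intF.support,
        |((coeff n (selOfGood hr hs0 hs1 hs2 hη hs hσ1 h).L.intF : ℤ) : ℝ)|) ≤
      38 * (D : ℝ) ^ (2 + β) := by
  set Λ := selOfGood hr hs0 hs1 hs2 hη hs hσ1 h with hΛ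
  have hP := (propsAt_ptSeq h.2.1).1
  have hD : 1 ≤ D := by have := h.1; omega
  have hT0 : 0 < Tl σ D := one_le_Tl (by linarith) hD
  have hnY := h.2.2.2.2.1
  have h9 := h.2.2.2.2.2.2.2.2.1
  have hY0 : 0 ≤ Yl β D := by
    rw [Yl]; exact mul_nonneg (by norm_num) (Real.rpow_nonneg (Nat.cast_nonneg _) _)
  have hPn : maxNorm (map (Int.castRingHom ℂ) (ptSeq ξ η r s σ β ν D)) ≤ Real.exp (Yl β D) :=
    (map_Pt_mem_nrBody hP hT0).2.1
  have hQn : maxNorm (map (Int.castRingHom ℂ) (compQ D (intModel r s β (ptSeq ξ η r s σ β ν) D) Λ.t)) ≤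
      Real.exp (Yl β D) :=
    (map_compQ_mem_nrBody hP hσ1 Λ.ht hnY h.2.2.2.2.2.1).2.1
  have hlen := Λ.L.length_intF_le
  have hlen1 := Λ.L.one_le_length_intF
  have hfact : (0 : ℝ) < ((Fintype.card (PhiRow D)).factorial : ℝ) :=
    Nat.cast_pos.mpr (Nat.factorial_pos _)
  set N₀ := Fintype.card ↥(finsuppAntidiag (univ : Finset (Fin 3)) (2 * D)) with hN₀
  set N₁ := Fintype.card ↥Λ.L.M₁ with hN₁
  have hN₁ : N₁ ≤ N₀ := card_M₁_le Λ.L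
  have hP0 : 0 ≤ maxNorm (map (Int.castRingHom ℂ) (ptSeq ξ η r s σ β ν D)) := maxNorm_nonneg _
  have hQ0 : 0 ≤ maxNorm (map (Int.castRingHom ℂ)
    (compQ D (intModel r s β (ptSeq ξ η r s σ β ν) D) Λ.t)) := maxNorm_nonneg _
  have hpowP := pow_le_pow_left₀ hP0 hPn N₀
  have hpowQ := pow_le_pow_left₀ hQ0 hQn N₁
  have hlen2 : ∑ n ∈ Λ.L.intF.support, |((coeff n Λ.L.intF : ℤ) : ℝ)| ≤
      ((Fintype.card (PhiRow D)).factorial : ℝ) * (Real.exp (Yl β D) ^ N₀ * Real.exp (Yl β D) ^ N₁) := by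
    refine hlen.trans (mul_le_mul_of_nonneg_left ?_ hfact.le)
    exact mul_le_mul hpowP hpowQ (pow_nonneg hQ0 _) (pow_nonneg (Real.exp_pos _).le _)
  have hpos1 : (0 : ℝ) < Real.exp (Yl β D) ^ N₀ := pow_pos (Real.exp_pos _) _
  have hpos2 : (0 : ℝ) < Real.exp (Yl β D) ^ N₁ := pow_pos (Real.exp_pos _) _
  have hN₁r : (N₁ : ℝ) ≤ N₀ := by exact_mod_cast hN₁
  calc Real.log (∑ n ∈ Λ.L.intF.support, |((coeff n Λ.L.intF : ℤ) : ℝ)|)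
      ≤ Real.log (((Fintype.card (PhiRow D)).factorial : ℝ) *
          (Real.exp (Yl β D) ^ N₀ * Real.exp (Yl β D) ^ N₁)) :=
        Real.log_le_log (lt_of_lt_of_le one_pos hlen1) hlen2
    _ = Real.log ((Fintype.card (PhiRow D)).factorial : ℝ) + N₀ * Yl β D + N₁ * Yl β D := by
        rw [Real.log_mul hfact.ne' (mul_pos hpos1 hpos2).ne', Real.log_mul hpos1.ne' hpos2.ne',
          Real.log_pow, Real.log_pow, Real.log_exp, add_assoc]
    _ ≤ Real.log ((Fintype.card (PhiRow D)).factorial : ℝ) + 2 * N₀ * Yl β D := by nlinarith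
    _ ≤ 38 * (D : ℝ) ^ (2 + β) := h9

/-- **Proposition 14 at a good level** (`A₁₄ = 4`, `B₁₄ = 77`). [cite: NguyenRoy2016, Proposition 14] -/
theorem prop14_of_good (hr : r ≠ 0) (hs0 : s ≠ 0) (hs1 : s ≠ 1) (hs2 : s ≠ -1) (hη : η ≠ 0)
    (hs : 1 < ‖(s : ℂ)‖) (hσ1 : 1 ≤ σ) (hσ2 : σ < 2) {D : ℕ} (h : Good ξ η r s σ β ν D) (Z : AlgPt)
    (hZ : IsIn r s σ (ptSeq ξ η r s σ β ν) Z D) (i : ℤ) (hi : |(i : ℝ)| < 3 * ⌊(D : ℝ) ^ σ⌋₊) :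
    (((Z.tauA r hs0 i).conj).card : ℝ) ≤ 4 * (D : ℝ) ^ (2 - σ) ∧
      (Z.tauA r hs0 i).ht ≤ 77 * (D : ℝ) ^ (1 + β - σ) := by
  set Λ := selOfGood hr hs0 hs1 hs2 hη hs hσ1 h with hΛ
  have hP := (propsAt_ptSeq h.2.1).1
  have hD : 1 ≤ D := by have := h.1; omega
  have hDr : (1 : ℝ) ≤ D := by exact_mod_cast hD
  have hD0 : (0 : ℝ) < D := by linarith
  have hT : (D : ℝ) ^ σ ≤ 2 * (Tl σ D : ℝ) := rpow_le_two_mul_natFloor hD (by linarith)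
  have hTpos : (0 : ℝ) < Tl σ D := by exact_mod_cast one_le_Tl (by linarith) hD
  have hσpow : 0 < (D : ℝ) ^ σ := Real.rpow_pos_of_pos hD0 _
  -- exponent algebra
  have h2σ : (D : ℝ) ^ (2 - σ) = (D : ℝ) ^ 2 / (D : ℝ) ^ σ := by
    rw [Real.rpow_sub hD0, Real.rpow_two]
  have h1βσ : (D : ℝ) ^ (1 + β - σ) = (D : ℝ) ^ (2 + β) / ((D : ℝ) * (D : ℝ) ^ σ) := by
    rw [show 1 + β - σ = (2 + β) - (1 + σ) by ring, Real.rpow_sub hD0, Real.rpow_add hD0 1 σ,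
      Real.rpow_one]
  have hone : (1 : ℝ) ≤ (D : ℝ) ^ (2 - σ) := Real.one_le_rpow hDr (by linarith)
  constructor
  · -- degree
    rw [AlgPt.card_conj]
    have hdeg := prop14_card_le Λ hP hD hσ1 hr hs0 hs1 hs2 hZ i
    have hfrac : (D : ℝ) ^ 2 / Tl σ D ≤ 2 * (D : ℝ) ^ (2 - σ) := by
      rw [h2σ, div_le_iff₀ hTpos]
      rw [show 2 * ((D : ℝ) ^ 2 / (D : ℝ) ^ σ) * Tl σ D = (D : ℝ) ^ 2 * (2 * Tl σ D) / (D : ℝ) ^ σ by ring,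
        le_div_iff₀ hσpow]
      nlinarith [sq_nonneg (D : ℝ)]
    linarith
  · -- height
    have hi' : |i| < 3 * Tl σ D := by
      have h1 : ((|i| : ℤ) : ℝ) < ((3 * Tl σ D : ℕ) : ℝ) := by
        rw [Int.cast_abs]; push_cast; exact hi
      exact_mod_cast h1
    have hht := prop14_ht_le_of_isIn Λ hP hD hσ1 hr hs0 hs1 hs2 h.2.2.2.2.1 hZ hi'
    have h9 := h.2.2.2.2.2.2.2.2.1
    have h10 := h.2.2.2.2.2.2.2.2.2
    have hY0 : 0 ≤ Yl β D := by
      rw [Yl]; exact mul_nonneg (by norm_num) (Real.rpow_nonneg (Nat.cast_nonneg _) _)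
    have hN₁ : (Fintype.card ↥Λ.L.M₁ : ℝ) ≤ Fintype.card ↥(finsuppAntidiag (univ : Finset (Fin 3)) (2 * D)) := by
      exact_mod_cast card_M₁_le Λ.L
    have hnum : Real.log ((Fintype.card (PhiRow D)).factorial : ℝ) +
        Fintype.card ↥(finsuppAntidiag (univ : Finset (Fin 3)) (2 * D)) * Yl β D +
        Fintype.card ↥Λ.L.M₁ * Yl β D ≤ 38 * (D : ℝ) ^ (2 + β) := by nlinarith
    have hDT : (0 : ℝ) < D * Tl σ D := mul_pos hD0 hTpos
    have hfrac : (Real.log ((Fintype.card (PhiRow D)).factorial : ℝ) +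
        Fintype.card ↥(finsuppAntidiag (univ : Finset (Fin 3)) (2 * D)) * Yl β D +
        Fintype.card ↥Λ.L.M₁ * Yl β D) / (D * Tl σ D) ≤ 76 * (D : ℝ) ^ (1 + β - σ) := by
      rw [div_le_iff₀ hDT]
      refine hnum.trans ?_
      rw [h1βσ, show 76 * ((D : ℝ) ^ (2 + β) / ((D : ℝ) * (D : ℝ) ^ σ)) * (D * Tl σ D) =
        (D : ℝ) ^ (2 + β) * (38 * (2 * Tl σ D)) / (D : ℝ) ^ σ by field_simp; ring,
        le_div_iff₀ hσpow]
      have h0 : 0 ≤ (D : ℝ) ^ (2 + β) := Real.rpow_nonneg hD0.le _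
      nlinarith
    linarith

/-- **Corollary 16 at a good level** (`κ = 1/640`), for `(ξ, η) ∉ ℚ̄ × ℚ̄`. [cite: NguyenRoy2016, Corollary 16] -/
theorem cor16_of_good (hr : r ≠ 0) (hs0 : s ≠ 0) (hs1 : s ≠ 1) (hs2 : s ≠ -1) (hη : η ≠ 0)
    (hs : 1 < ‖(s : ℂ)‖) (hσ1 : 1 ≤ σ) (hξη : ¬ (IsAlgebraic ℚ ξ ∧ IsAlgebraic ℚ η)) {D : ℕ}
    (h : Good ξ η r s σ β ν D) :
    ∃ ι : PPt → ℤ, (∀ a ∈ (selOfGood hr hs0 hs1 hs2 hη hs hσ1 h).Z.conj,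
        0 ≤ ι a ∧ ι a < (⌊(D : ℝ) ^ σ⌋₊ : ℕ)) ∧
      ∑ a ∈ (selOfGood hr hs0 hs1 hs2 hη hs hσ1 h).Z.conj,
          ((D : ℝ) ^ β + Real.log (pdist a (gamP ξ η (r : ℂ) (s : ℂ) (ι a)))) ≤
        -((1 / 640) * (D : ℝ) ^ (ν - β + σ - 2) *
          (2 * (D : ℝ) ^ β * ((selOfGood hr hs0 hs1 hs2 hη hs hσ1 h).Z.conj).card +
            D * (selOfGood hr hs0 hs1 hs2 hη hs hσ1 h).Z.ht)) := by
  set Λ := selOfGood hr hs0 hs1 hs2 hη hs hσ1 h with hΛ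
  have hD : 1 ≤ D := by have := h.1; omega
  have hDr : (1 : ℝ) ≤ D := by exact_mod_cast hD
  have hD0 : (0 : ℝ) < D := by linarith
  obtain ⟨ι, hιT, -, hsum⟩ := Λ.cor16 hD hr hη hs0 hs h.2.2.1 hξη (by linarith)
  refine ⟨fun a => (ι a : ℤ), fun a _ => ⟨Int.natCast_nonneg _, ?_⟩, ?_⟩
  · change ((ι a : ℕ) : ℤ) < ((Tl σ D : ℕ) : ℤ)
    exact_mod_cast hιT a
  -- abbreviations
  set w : ℝ := 2 * (D : ℝ) ^ β * Λ.Z.deg + D * Λ.Z.ht with hw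
  set Bv : ℝ := 2 * (D : ℝ) ^ β * (D : ℝ) ^ 2 + D * ∑ j, (Λ.L.e j : ℝ) * habs (Λ.L.pt j) with hBv
  have hβ0 : 0 < (D : ℝ) ^ β := Real.rpow_pos_of_pos hD0 _
  have hdeg1 : (1 : ℝ) ≤ Λ.Z.deg := by exact_mod_cast Λ.Z.one_le_deg
  have hht0 : 0 ≤ Λ.Z.ht := AlgPt.ht_nonneg _
  have hw0 : 0 ≤ w := by rw [hw]; positivity
  have hsum0 : 0 ≤ (D : ℝ) * ∑ j, (Λ.L.e j : ℝ) * habs (Λ.L.pt j) :=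
    mul_nonneg hD0.le (sum_nonneg fun j _ => mul_nonneg (Nat.cast_nonneg _) (habs_nonneg _))
  have hBv0 : 0 < Bv := by
    rw [hBv]
    have : 0 < 2 * (D : ℝ) ^ β * (D : ℝ) ^ 2 := by positivity
    linarith
  -- `Bv ≤ 40 D^{2+β}`
  have hlogL := log_length_le_of_good hr hs0 hs1 hs2 hη hs hσ1 h
  have hBvle : Bv ≤ 40 * (D : ℝ) ^ (2 + β) := by
    have h1 := Λ.L.mul_sum_e_habs_le (closureField Λ.L.coords) Λ.L.mem_closureField_coords
    have h2 : 2 * (D : ℝ) ^ β * (D : ℝ) ^ 2 = 2 * (D : ℝ) ^ (2 + β) := by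
      rw [Real.rpow_add hD0, Real.rpow_two]; ring
    rw [hBv, h2]
    linarith
  -- the main chain
  have h7 := h.2.2.2.2.2.2.1
  have h8 := h.2.2.2.2.2.2.2.1
  have hA : 0 < (D : ℝ) ^ (σ + ν) / 16 := by positivity
  have hstep1 : ∑ a ∈ Λ.Z.conj, ((D : ℝ) ^ β + Real.log (pdist a (gamP ξ η (r : ℂ) (s : ℂ) (ι a)))) ≤
      ∑ a ∈ Λ.Z.conj, (Yl β D - Real.log (2 * c10 ξ η (r : ℂ) (s : ℂ) (Lc σ D)) +
        Real.log (pdist a (gamP ξ η (r : ℂ) (s : ℂ) (ι a)))) := by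
    refine sum_le_sum fun a _ => ?_
    rw [Yl]
    linarith
  have hstep2 : w / Bv * Real.log (S0 σ β ν D) - D * Λ.Z.ht ≤ -(w * ((D : ℝ) ^ (σ + ν) / 16) / (40 * (D : ℝ) ^ (2 + β))) := by
    have h1 : w / Bv * Real.log (S0 σ β ν D) ≤ w / Bv * (-((D : ℝ) ^ (σ + ν)) / 16) :=
      mul_le_mul_of_nonneg_left h7 (div_nonneg hw0 hBv0.le)
    have h2 : w / Bv * (-((D : ℝ) ^ (σ + ν)) / 16) = -(w * ((D : ℝ) ^ (σ + ν) / 16) / Bv) := by ring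
    have h3 : w * ((D : ℝ) ^ (σ + ν) / 16) / (40 * (D : ℝ) ^ (2 + β)) ≤
        w * ((D : ℝ) ^ (σ + ν) / 16) / Bv :=
      div_le_div_of_nonneg_left (mul_nonneg hw0 hA.le) hBv0 hBvle
    have h4 : 0 ≤ (D : ℝ) * Λ.Z.ht := mul_nonneg hD0.le hht0
    linarith
  have hexp : (D : ℝ) ^ (σ + ν) / (D : ℝ) ^ (2 + β) = (D : ℝ) ^ (ν - β + σ - 2) := by
    rw [← Real.rpow_sub hD0]; congr 1; ring
  have hfinal : -(w * ((D : ℝ) ^ (σ + ν) / 16) / (40 * (D : ℝ) ^ (2 + β))) =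
      -((1 / 640) * (D : ℝ) ^ (ν - β + σ - 2) * w) := by
    rw [← hexp]
    field_simp
    ring
  rw [AlgPt.card_conj]
  calc ∑ a ∈ Λ.Z.conj, ((D : ℝ) ^ β + Real.log (pdist a (gamP ξ η (r : ℂ) (s : ℂ) (ι a))))
      ≤ _ := hstep1
    _ ≤ w / Bv * Real.log (S0 σ β ν D) - D * Λ.Z.ht := hsum
    _ ≤ -(w * ((D : ℝ) ^ (σ + ν) / 16) / (40 * (D : ℝ) ^ (2 + β))) := hstep2
    _ = -((1 / 640) * (D : ℝ) ^ (ν - β + σ - 2) * w) := hfinal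

end good

/-! ### The endgame data -/

section endgame

variable {ξ η : ℂ} {r s : ℚ} {σ β ν : ℝ}

/-- **The `EndgameData` of Nguyen–Roy's proof** for `|s| > 1` and `(ξ, η) ∉ ℚ̄ × ℚ̄`, under the
hypotheses of Theorem 1. [cite: NguyenRoy2016, §§2, 4, 5 (the objects) and §6 (their use)] -/
def endgame (hη : η ≠ 0) (hr : r ≠ 0) (hs0 : s ≠ 0) (hs1 : s ≠ 1) (hs2 : s ≠ -1)
    (hs : 1 < ‖(s : ℂ)‖) (hσ1 : 1 ≤ σ) (hσ2 : σ < 2) (hβ : σ + 1 < β) (hν : 2 + β - σ < ν)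
    (hξη : ¬ (IsAlgebraic ℚ ξ ∧ IsAlgebraic ℚ η))
    (hP : ∀ᶠ D : ℕ in atTop, ∃ P : MvPolynomial (Fin 2) ℤ, P ≠ 0 ∧ P.totalDegree ≤ D ∧
      (mvPolyHeight P : ℝ) ≤ Real.exp ((D : ℝ) ^ β) ∧
      ∀ i : ℕ, i < 4 * ⌊(D : ℝ) ^ σ⌋₊ →
        ‖aeval ![ξ + (i : ℂ) * (r : ℂ), η * (s : ℂ) ^ i] P‖ ≤ Real.exp (-(D : ℝ) ^ ν)) :
    EndgameData σ β ν :=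
  have hgood := Filter.eventually_atTop.mp (eventually_good hη hs0 hs hσ1 hσ2 hβ hν hP)
  { Pt := PPt
    V := AlgPt
    dist := pdist
    dist_nonneg := pdist_nonneg
    dist_le_two := pdist_le_two
    dist_comm := pdist_comm
    dist_triangle := pdist_triangle
    τ := tauQ r hs0
    τ_zero := AlgPt.tauQ_zero r hs0
    τ_τ := AlgPt.tauQ_tauQ r hs0
    c₁ := Real.log (tauConst (r : ℂ) (s : ℂ))
    c₁_nonneg := Real.log_nonneg (one_le_tauConst (r : ℂ) (cast_ne_zero' hs0))
    dist_τ_le := fun i a b => pdist_tauP_le (r : ℂ) (cast_ne_zero' hs0) i a b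
    γ := gamP ξ η (r : ℂ) (s : ℂ)
    τ_γ := fun i j => tauP_gamP ξ η (r : ℂ) (cast_ne_zero' hs0) i j
    pts := AlgPt.conj
    pts_nonempty := AlgPt.conj_nonempty
    ht := AlgPt.ht
    ht_nonneg := AlgPt.ht_nonneg
    τV := fun i Z => Z.tauA r hs0 i
    τV_zero := fun Z => Z.tauA_zero r hs0
    τV_τV := fun i j Z => Z.tauA_tauA r hs0 i j
    mem_pts_τV := fun i Z b => Z.mem_conj_tauA r hs0 i b
    c₄ := AlgPt.c4 r s
    c₄_nonneg := AlgPt.c4_nonneg r hs0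
    ht_τV_le := fun i Z => by
      rw [AlgPt.card_conj]
      exact Z.ht_tauA_le r hs0 i
    c₁₂ := Real.log 2
    c₁₂_nonneg := Real.log_nonneg (by norm_num)
    liouville := fun Z Z' a ha a' ha' hne => by
      rw [AlgPt.card_conj, AlgPt.card_conj]
      exact AlgPt.liouville_conj Z Z' ha ha' hne
    dist_γ_pos := fun Z a ha i => pdist_pos_of_mem_conj_gamP ξ η r hs0 hη hξη Z ha i
    IsIn := IsIn r s σ (ptSeq ξ η r s σ β ν)
    isIn_of_mem := fun D Z Z' b hb hb' h => isIn_of_mem D Z Z' b hb hb' h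
    D₀ := hgood.choose
    A₁₄ := 4
    B₁₄ := 77
    one_le_A₁₄ := by norm_num
    one_le_B₁₄ := by norm_num
    prop14 := fun D hD Z hZ i hi =>
      prop14_of_good hr hs0 hs1 hs2 hη hs hσ1 hσ2 (hgood.choose_spec D hD) Z hZ i hi
    Z := Zseq ξ η r s σ β ν hr hs0 hs1 hs2 hη hs hσ1
    isIn_Z := fun D hD => by
      have hg := hgood.choose_spec D hD
      rw [Zseq, dif_pos hg]
      exact (selOfGood hr hs0 hs1 hs2 hη hs hσ1 hg).isIn (propsAt_ptSeq hg.2.1).1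
    κ := 1 / 640
    κ_pos := by norm_num
    cor16 := fun D hD => by
      have hg := hgood.choose_spec D hD
      have h := cor16_of_good (β := β) (ν := ν) hr hs0 hs1 hs2 hη hs hσ1 hξη hg
      simp only [Zseq, dif_pos hg]
      exact h
    c₇ := 0
    c₇_nonneg := le_rfl
    notIn := fun D hD Zv hZv => by
      have hg := hgood.choose_spec D hD
      exact notIn hs0 (propsAt_ptSeq hg.2.1).1 Zv hZv }

end endgame

/-! ### Theorem 1 -/

/-- **Theorem 1 for `|s| > 1`** (all `1 ≤ σ < 2`). [cite: NguyenRoy2016, Theorem 1 and §6 (proof, for `|s| > 1`)] -/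
theorem thm1_of_one_lt_abs_s (ξ η : ℂ) (hη : η ≠ 0) (r s : ℚ) (hr : r ≠ 0) (hs : 1 < |s|)
    (σ β ν : ℝ) (hσ1 : 1 ≤ σ) (hσ2 : σ < 2) (hβ : σ + 1 < β)
    (hν1 : 3 / 2 ≤ σ → 2 + β - σ < ν)
    (hν2 : σ < 3 / 2 → 2 + β - σ + (σ - 1) * (3 - 2 * σ) / (2 + β - 2 * σ) < ν)
    (hP : ∀ᶠ D : ℕ in atTop, ∃ P : MvPolynomial (Fin 2) ℤ, P ≠ 0 ∧ P.totalDegree ≤ D ∧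
      (mvPolyHeight P : ℝ) ≤ Real.exp ((D : ℝ) ^ β) ∧
      ∀ i : ℕ, i < 4 * ⌊(D : ℝ) ^ σ⌋₊ →
        ‖aeval ![ξ + (i : ℂ) * (r : ℂ), η * (s : ℂ) ^ i] P‖ ≤ Real.exp (-(D : ℝ) ^ ν)) :
    IsAlgebraic ℚ ξ ∧ IsAlgebraic ℚ η := by
  by_contra hξη
  have hs0 : s ≠ 0 := fun h => by rw [h, abs_zero] at hs; exact absurd hs (by norm_num)
  have hs1 : s ≠ 1 := fun h => by rw [h, abs_one] at hs; exact lt_irrefl _ hs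
  have hs2 : s ≠ -1 := fun h => by rw [h, abs_neg, abs_one] at hs; exact lt_irrefl _ hs
  have hsC : 1 < ‖(s : ℂ)‖ := by
    rw [← Complex.ofReal_ratCast, Complex.norm_real, Real.norm_eq_abs]
    exact_mod_cast hs
  have hν : 2 + β - σ < ν := EndgameData.two_add_sub_lt_nu hσ1 hβ hν1 hν2
  exact (endgame hη hr hs0 hs1 hs2 hsC hσ1 hσ2 hβ hν hξη hP).false_of_constraints hσ1 hσ2 hβ hν1 hν2

/-- **Theorem 1 for `1 < σ < 2`** and every `s ≠ 0, ±1` (the case `|s| < 1` by the repaired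
Lemma 3 of `RoySmallValueEstimatesReductionProofs`). [cite: NguyenRoy2016, Theorem 1 and Lemma 3] -/
theorem thm1_of_one_lt_sigma (ξ η : ℂ) (hη : η ≠ 0) (r s : ℚ) (hr : r ≠ 0) (hs0 : s ≠ 0) (hs1 : s ≠ 1)
    (hs2 : s ≠ -1) (σ β ν : ℝ) (h1 : 1 < σ) (h2 : σ < 2) (hβ : σ + 1 < β)
    (hν1 : 3 / 2 ≤ σ → 2 + β - σ < ν)
    (hν2 : σ < 3 / 2 → 2 + β - σ + (σ - 1) * (3 - 2 * σ) / (2 + β - 2 * σ) < ν)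
    (hP : ∀ᶠ D : ℕ in atTop, ∃ P : MvPolynomial (Fin 2) ℤ, P ≠ 0 ∧ P.totalDegree ≤ D ∧
      (mvPolyHeight P : ℝ) ≤ Real.exp ((D : ℝ) ^ β) ∧
      ∀ i : ℕ, i < 4 * ⌊(D : ℝ) ^ σ⌋₊ →
        ‖aeval ![ξ + (i : ℂ) * (r : ℂ), η * (s : ℂ) ^ i] P‖ ≤ Real.exp (-(D : ℝ) ^ ν)) :
    IsAlgebraic ℚ ξ ∧ IsAlgebraic ℚ η :=
  thm1_of_one_lt_abs (fun ξ η hη r s hr hs σ β ν hσ1 hσ2 hβ hν1 hν2 hP' =>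
    thm1_of_one_lt_abs_s ξ η hη r s hr hs σ β ν hσ1 hσ2 hβ hν1 hν2 hP')
    ξ η hη r s hr hs0 hs1 hs2 σ β ν h1 h2 hβ hν1 hν2 hP

end NguyenRoy

/-! ### The corrected named fact -/

/-- **Nguyen–Roy's small value estimate at rational translates, outside the corner
`σ = 1 ∧ |s| < 1`**: the statement of `nguyenRoy2016_thm_1` (Nguyen–Roy 2016, Theorem 1) with the
extra hypothesis `1 < σ ∨ 1 < |s|`. This is exactly what the printed proof establishes: §§3–6 prove
the theorem for `|s| > 1`, and Lemma 3 reduces `|s| < 1` to `|s| > 1` through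
`P̃_D = X₂^{⌊D/2⌋}P_{⌊D/2⌋}(X₁, X₂⁻¹)`, which satisfies the small-value hypothesis at
`4⌊⌊D/2⌋^σ⌋` translates only, instead of the `4⌊D^σ⌋` required; for `σ > 1` the loss is absorbed
by shrinking `(σ, ν)` inside the open constraints (1) (`RoySmallValueEstimatesReductionProofs`),
while at `σ = 1` (where `1 ≤ σ` leaves no room) the printed reduction does not go through. Named
fact recording the proved scope; the unrestricted `nguyenRoy2016_thm_1` keeps the printed claim.
[cite: NguyenRoy2016, Theorem 1, Lemma 3 and §6] -/
def nguyenRoy2016_thm_1' : Prop :=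
  ∀ (ξ η : ℂ), η ≠ 0 → ∀ (r s : ℚ), r ≠ 0 → s ≠ 0 → s ≠ 1 → s ≠ -1 →
    ∀ (σ β ν : ℝ), 1 ≤ σ → σ < 2 → σ + 1 < β →
    (3 / 2 ≤ σ → 2 + β - σ < ν) →
    (σ < 3 / 2 → 2 + β - σ + (σ - 1) * (3 - 2 * σ) / (2 + β - 2 * σ) < ν) →
    (1 < σ ∨ 1 < |s|) →
    (∀ᶠ D : ℕ in atTop, ∃ P : MvPolynomial (Fin 2) ℤ, P ≠ 0 ∧ P.totalDegree ≤ D ∧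
      (mvPolyHeight P : ℝ) ≤ Real.exp ((D : ℝ) ^ β) ∧
      ∀ i : ℕ, i < 4 * ⌊(D : ℝ) ^ σ⌋₊ →
        ‖aeval ![ξ + (i : ℂ) * (r : ℂ), η * (s : ℂ) ^ i] P‖ ≤ Real.exp (-(D : ℝ) ^ ν)) →
    IsAlgebraic ℚ ξ ∧ IsAlgebraic ℚ η

/-- **`nguyenRoy2016_thm_1'` holds.** [cite: NguyenRoy2016, Theorem 1, Lemma 3 and §6] -/
theorem nguyenRoy2016_thm_1'_holds : nguyenRoy2016_thm_1' := by
  intro ξ η hη r s hr hs0 hs1 hs2 σ β ν hσ1 hσ2 hβ hν1 hν2 hcase hP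
  rcases hcase with h | h
  · exact NguyenRoy.thm1_of_one_lt_sigma ξ η hη r s hr hs0 hs1 hs2 σ β ν h hσ2 hβ hν1 hν2 hP
  · exact NguyenRoy.thm1_of_one_lt_abs_s ξ η hη r s hr h σ β ν hσ1 hσ2 hβ hν1 hν2 hP

/-- The unrestricted fact follows from the corner case alone: if Theorem 1 holds for `σ = 1` and
`|s| < 1`, then `nguyenRoy2016_thm_1` holds. [cite: NguyenRoy2016, Theorem 1] -/
theorem nguyenRoy2016_thm_1_of_corner
    (hcorner : ∀ (ξ η : ℂ), η ≠ 0 → ∀ (r s : ℚ), r ≠ 0 → s ≠ 0 → |s| < 1 →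
      ∀ (β ν : ℝ), (1 : ℝ) + 1 < β → 2 + β - 1 < ν →
      (∀ᶠ D : ℕ in atTop, ∃ P : MvPolynomial (Fin 2) ℤ, P ≠ 0 ∧ P.totalDegree ≤ D ∧
        (mvPolyHeight P : ℝ) ≤ Real.exp ((D : ℝ) ^ β) ∧
        ∀ i : ℕ, i < 4 * ⌊(D : ℝ) ^ (1 : ℝ)⌋₊ →
          ‖aeval ![ξ + (i : ℂ) * (r : ℂ), η * (s : ℂ) ^ i] P‖ ≤ Real.exp (-(D : ℝ) ^ ν)) →
      IsAlgebraic ℚ ξ ∧ IsAlgebraic ℚ η) :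
    nguyenRoy2016_thm_1 := by
  intro ξ η hη r s hr hs0 hs1 hs2 σ β ν hσ1 hσ2 hβ hν1 hν2 hP
  by_cases hσ : 1 < σ
  · exact nguyenRoy2016_thm_1'_holds ξ η hη r s hr hs0 hs1 hs2 σ β ν hσ1 hσ2 hβ hν1 hν2 (Or.inl hσ) hP
  · have hσ' : σ = 1 := le_antisymm (not_lt.mp hσ) hσ1
    by_cases habs : 1 < |s|
    · exact nguyenRoy2016_thm_1'_holds ξ η hη r s hr hs0 hs1 hs2 σ β ν hσ1 hσ2 hβ hν1 hν2 (Or.inr habs) hP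
    · have habs' : |s| < 1 := by
        rcases lt_or_eq_of_le (not_lt.mp habs) with h | h
        · exact h
        · exfalso
          rcases (abs_eq zero_le_one).mp h with h' | h'
          · exact hs1 h'
          · exact hs2 h'
      subst hσ'
      have hν : 2 + β - 1 < ν := by
        have := hν2 (by norm_num)
        norm_num at this
        linarith
      exact hcorner ξ η hη r s hr hs0 habs' β ν hβ hν hP

end Literature.NumberTheory.Transcendental
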